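import Summits.HodgeConjecture.HodgeConjecture.Theorems.EisensteinMiddleThirdAssembly

/-!
# Route EisensteinMiddleThird — `SectorFrame` (support item stmt-HodgeConjecture-16813)

`TowerMiddleAlgebraic → EisensteinTowerHodge` — literally the tree's
`eisensteinMiddleThird_eisensteinTowerHodge_of_towerMiddleAlgebraic` (file `EisensteinMiddleThirdAssembly`:
the unconditional reduction of the Hodge conjecture for a smooth projective fourfold to its rational
`(2,2)`-classes, `hodgeConjectureFor_four_of_hodgeTwoTwo`).  No named-fact hypothesis, no sorry.
-/

-- `Summit.HodgeConjecture.HodgeConjecture.Theorems` is the mandated namespace (single-problem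
-- summit: Problem = Summit), which `linter.dupNamespace` flags on every declaration; the lakefile
-- turns the linter off tree-wide (weak option), restated here so stand-alone elaboration is
-- warning-free too.
set_option linter.dupNamespace false

namespace Summit.HodgeConjecture.HodgeConjecture.Theorems

/-- **Item stmt-HodgeConjecture-16813 (`SectorFrame`), route `EisensteinMiddleThird`**:
`TowerMiddleAlgebraic → EisensteinTowerHodge` by `eisensteinMiddleThird_eisensteinTowerHodge_of_towerMiddleAlgebraic`.
[cite: Murre1977, Remark 1 (p. 230)] -/
theorem eisensteinMiddleThird_sectorFrame_proof :
    Summit.HodgeConjecture.HodgeConjecture.Theses.EisensteinMiddleThird.SectorFrame :=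
  eisensteinMiddleThird_eisensteinTowerHodge_of_towerMiddleAlgebraic

end Summit.HodgeConjecture.HodgeConjecture.Theorems
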